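import Literature.NumberTheory.LFunctions.FordLemma45Contour
import Literature.NumberTheory.LFunctions.FordLemma41
import Literature.NumberTheory.LFunctions.FordZetaZeroRecipSqSum
import Literature.NumberTheory.LFunctions.FordZetaZeroDetectorLimit
import Literature.NumberTheory.LFunctions.VinogradovKorobovIntermediateDetector
import Literature.NumberTheory.LFunctions.VinogradovKorobovLemma47
import HarnessLib

/-!
# Ford's Lemma 4.6 for every admissible smoothing, and the two MTY zero inequalities with the detector discharged

Topic `Literature/NumberTheory/LFunctions`, family RH (explicit zero-free regions). Everything in
this file is PROVED; no named fact, no definition.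

K. Ford, *Zero-free regions for the Riemann zeta function* (2002), **Lemma 4.6** (=
Mossinghoff–Trudgian–Yang, arXiv:2212.06867, **Lemma 4.2** with Lemma 4.3 inserted): for (3.1) with
constants `A, B`, `0 < η ≤ 1/2`, a compactly supported smoothing `f` with (4.5)
(`|F₀(z)| ≤ D/|z|²`, `Re z ≥ 0`, `|z| ≥ η`) and `s = 1 + it`, `t ≥ 1000`:
`Re K(s) ≤ −Σ_{|1+it−ρ|≤η} Re{F(s−ρ) + f(0)((π/2η)cot(π(s−ρ)/2η) − 1/(s−ρ))}
  + (f(0)/2η)[(2/3) log log t + Bη^{3/2} log t + log A − ½∫ log|ζ(s+η+2ηiu/π)|/cosh²u du]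
  + D(1.8 + (log t)/3 + Σ_{|1+it−ρ|>η} 1/|1+it−ρ|²)`, and `K(1) ≤ F(0) + 1.8D`.
Here it is proved for EVERY smoothing of the tree's class `IsFordSmoothing f η D` (`C¹`, `f ≥ 0`,
compact support, (4.5)) — the class over which the in-tree assemblies of MTY Lemmas 4.7 and 6.1
quantify — whereas `FordLemma46.lean` (`FordL46.…`) proves the raw form for the `C²` smoothings of
the exact explicit formula. Results (namespace `FordL46S`):

* `ford_lemma_4_6` — for `A ≥ 6`, `B > 0`, `RichertBound A B`, `0 < η ≤ 1/2`,
  `IsFordSmoothing f η D`: `(∀ t ≥ 1000, ∀ S, FordFarZeroSumLT t η S → FordDetectorIneq A B η f D t S)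
  ∧ (fordK f 1).re ≤ (fordLaplace f 0).re + 1.8 D` — the hypothesis `h42` of
  `zero_inequality_mossinghoff_trudgian_yang_of_hsw` for `A ≥ 6` (the named fact quantifies
  `A > 6.5`; `A ≥ 6` comes from Ford's Lemma 3.4 on `Re s = 1 − η` inside Lemma 4.1);
* `fordDetectorIneqRaw`, `h42_raw` — the raw form `FordDetectorIneqRaw η f D t S` (both `log|ζ|`
  integrals kept; no (3.1)) for every `η ∈ (0, 1/2]`, `t ≥ 1000`: the hypothesis `h42` of
  `zero_inequality_intermediate_of_ford'` (`VinogradovKorobovIntermediateDetector.lean`);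
* `zero_inequality_intermediate_of_patel_91` — **MTY Lemma 6.1** (the named fact
  `zero_inequality_intermediate_mossinghoff_trudgian_yang`) from Patel's bound
  (`zeta_half_line_patel`), Ford's (9.1) and `Σ ≤ 0.851` only;
* `zeroInequalityMTYWith_of_h45`, `zero_inequality_mossinghoff_trudgian_yang_of_h45` — **MTY
  Lemma 4.7** (the named fact `zero_inequality_mossinghoff_trudgian_yang`, resp. its version with
  the Lemma-4.5 constant as a parameter) from MTY Lemma 4.5 and (3.8)
  (`zetaZeroCount_hasanalizade_shen_wong`) only.

Proof of Lemma 4.6 (Ford's, p. 9 of arXiv:1910.08205): Lemma 4.5 at `σ + it`, `1 < σ ≤ 2`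
(`FordL45.re_fordK_le`, `FordLemma45Contour.lean`) and `σ → 1⁺` — `re_fordK_one_add_le` (every
term is continuous: `K` is a finite sum, `ζ(1 + it) ≠ 0`, `F₀` is analytic off `0`); then EITHER
Lemma 4.1 at `1 + it` (`FordLemma41.ford_lemma_4_1_one`) — giving `FordDetectorIneq` — OR Ford's
zero detector at `σ = 1` for every `η` (`FordZetaDetector.ford_zero_detector_zeta_one`) — giving
the raw form; in both the near zeros of real part `≤ 1 − η` drop out of the cotangent sum
(`sum_fordCot_near_eq_filter`: such a zero is `1 − η + it`, `cot(π/2) = 0`), `|F₀(it)| ≤ D/t²`, and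
`1/t² + 4.62/3 + (log 2)/3 + (1/6) log(1+t²) ≤ 1.8 + (log t)/3` (`numerics_46`; Ford's
`1.72 + 0.001` with the corrected `1.771`). For `K(1)`: `FordL45.re_fordK_le_zero` at real
`σ ∈ (1, 2]`, no zero has `|1 − ρ| ≤ 1/2` (`FordL33.fourteen_lt_abs_im`),
`Σ m(ρ)/|1 − ρ|² ≤ 0.0463` (Ford's Lemma 3.3, `FordZetaZeroRecipSqSum.lean`),
`−ζ'/ζ(σ) < 1/(σ − 1)` (Lemma 3.1), `F₀(σ−1) + f(0)/(σ−1) = F(σ−1)`, so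
`K(σ) ≤ F(σ − 1) + (0.0463 + 4.62/3 + (log 2)/3 − 1/16) D ≤ F(σ−1) + 1.8D`, and `σ → 1⁺`.

## References

* K. Ford, *Zero-free regions for the Riemann zeta function*, Number Theory for the Millennium II
  (Urbana 2000), A K Peters 2002, 25–56 (arXiv:1910.08205), Lemma 4.6. [Ford2002Millennium]
* M. J. Mossinghoff, T. S. Trudgian, A. Yang, *Explicit zero-free regions for the Riemann
  zeta-function*, Res. Number Theory 10 (2024), arXiv:2212.06867, Lemmas 4.2, 4.7, 6.1.
  [MossinghoffTrudgianYangRNT2024]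
-/

noncomputable section

open Complex Real MeasureTheory Set Filter Topology

namespace Literature.NumberTheory.LFunctions

namespace FordL46S

open Literature.Analysis.Complex.FordDetector FordL45

/-! ### Continuity of `Re K_f` -/

/-- `s ↦ Re K_f(s)` is continuous (`K_f` is a finite sum of `Λ(n) f(log n) n^{−s}` when `f`
vanishes on `[x₀, ∞)`). [folklore] -/
theorem continuous_re_fordK {f : ℝ → ℝ} {x₀ : ℝ} (hf0 : ∀ u, x₀ ≤ u → f u = 0) :
    Continuous fun s ↦ (fordK f s).re := by
  obtain ⟨N, hN⟩ := exists_nat_gt (Real.exp x₀)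
  have hN1 : 1 ≤ N := by
    have : (0 : ℝ) < N := (Real.exp_pos _).trans hN
    exact_mod_cast this
  have hx : x₀ ≤ Real.log N := by
    rw [← Real.log_exp x₀]
    exact Real.log_le_log (Real.exp_pos _) hN.le
  have heq : fordK f = fun s ↦ ∑ n ∈ Finset.range N,
      ((ArithmeticFunction.vonMangoldt n : ℝ) : ℂ) * (f (Real.log n) : ℂ) * (n : ℂ) ^ (-s) :=
    funext fun s ↦ fordK_eq_sum hf0 hN1 hx s
  rw [heq]
  refine Complex.continuous_re.comp (continuous_finsetSum _ fun n _ ↦ ?_)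
  rcases Nat.eq_zero_or_pos n with rfl | hn
  · simp only [ArithmeticFunction.map_zero, ofReal_zero, zero_mul]
    exact continuous_const
  · exact continuous_const.mul (continuous_const.cpow continuous_neg (fun s ↦ Or.inl (by exact_mod_cast hn)))

/-! ### The far-zero sum at `t = 0` and the near zeros at `t = 0` -/

/-- `Σ_{ρ ∈ T} m(ρ)/|1 − ρ|² ≤ 0.0463` for every finite set of non-trivial zeros (Ford's Lemma 3.3
with the reflection `ρ ↦ 1 − ρ̄`, `tsum_zeroOrder_div_norm_one_sub_sq_le`): the far-zero
bound at `t = 0` for every threshold `r`. [cite: Ford2002Millennium, Lemma 3.3 and Lemma 4.6 (proof)] -/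
theorem fordFarZeroSumLT_zero (r : ℝ) : FordFarZeroSumLT 0 r 0.0463 := by
  classical
  intro T hT
  simp only [ofReal_zero, zero_mul, add_zero]
  -- summability of `m(ρ)/|1 − ρ|²` over the non-trivial zeros
  set g : RHWave0.riemannZetaNontrivialZeros → ℝ := fun ρ ↦
    (riemannZetaZeroOrder (ρ : ℂ) : ℝ) / ‖1 - (ρ : ℂ)‖ ^ 2 with hg
  have hsum : Summable g := by
    have h := FordL33.summable_order_div_norm_sq
    have e : g = (fun ρ : RHWave0.riemannZetaNontrivialZeros ↦
        (riemannZetaZeroOrder (ρ : ℂ) : ℝ) / ‖(ρ : ℂ)‖ ^ 2) ∘ FordL33.reflEquiv := by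
      funext ρ
      simp only [Function.comp_apply, hg, FordL33.reflEquiv, Function.Involutive.coe_toPerm]
      rw [FordL33.order_refl, FordL33.norm_refl]
    rw [e]
    exact (FordL33.reflEquiv.summable_iff).2 h
  -- embed `T` into the index type
  have hmem : ∀ ρ ∈ T, ρ ∈ RHWave0.riemannZetaNontrivialZeros := fun ρ hρ ↦
    ZetaZeros.riemannZetaNontrivialZeros.mem_of_re_pos (hT ρ hρ).1 (hT ρ hρ).2.1
  set emb : {x // x ∈ T} → RHWave0.riemannZetaNontrivialZeros := fun x ↦ ⟨x.1, hmem x.1 x.2⟩ with hemb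
  have hinj : Function.Injective emb := by
    intro x y h
    exact Subtype.ext (congrArg (fun ρ : RHWave0.riemannZetaNontrivialZeros ↦ (ρ : ℂ)) h)
  set F : Finset RHWave0.riemannZetaNontrivialZeros := T.attach.image emb with hF
  have key : ∑ ρ ∈ T, (riemannZetaZeroOrder ρ : ℝ) / ‖1 - ρ‖ ^ 2 = ∑ y ∈ F, g y := by
    rw [hF, Finset.sum_image (fun x _ y _ h ↦ hinj h), ← Finset.sum_attach T]
  rw [key]
  refine le_trans (hsum.sum_le_tsum F fun ρ _ ↦ ?_) tsum_zeroOrder_div_norm_one_sub_sq_le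
  exact div_nonneg (FordL33.order_pos ρ).le (sq_nonneg _)

/-- There are no zeros with `|1 − ρ| ≤ η ≤ 1/2` (such a zero would be non-trivial with
`|Im ρ| ≤ 1/2 < 14`). [folklore] -/
theorem fordNearZeros_zero_eq_empty {η : ℝ} (hη2 : η ≤ 1 / 2) : fordNearZeros 0 η = ∅ := by
  rw [Finset.eq_empty_iff_forall_notMem]
  intro ρ hρ
  rw [mem_fordNearZeros] at hρ
  simp only [ofReal_zero, zero_mul, add_zero] at hρ
  obtain ⟨hζ, hn⟩ := hρ
  have hre : 0 < ρ.re := by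
    have h1 := Complex.abs_re_le_norm (1 - ρ)
    simp only [sub_re, one_re] at h1
    linarith [(abs_le.1 (h1.trans hn)).2]
  have hmem := ZetaZeros.riemannZetaNontrivialZeros.mem_of_re_pos hζ hre
  have h14 := FordL33.fourteen_lt_abs_im ⟨ρ, hmem⟩
  have h2 := Complex.abs_im_le_norm (1 - ρ)
  simp only [sub_im, one_im, zero_sub, abs_neg] at h2
  simp only at h14
  linarith [h2.trans hn]

/-! ### `K(1) ≤ F(0) + 1.8 D` -/

/-- **Ford 2002, Lemma 4.6, second assertion: `K(1) ≤ F(0) + 1.8 D`** for every admissible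
smoothing (`IsFordSmoothing f η D`, `0 < η ≤ 1/2`). Ford: "`K(σ) ≤ f(0)/(σ−1) + F₀(σ−1) + 1.8D
= F(σ−1) + 1.8D`" and `σ → 1⁺`; here from `FordL45.re_fordK_le_zero` (no zero has `|1 − ρ| ≤ η`,
`Σ m(ρ)/|1−ρ|² ≤ 0.0463`, `−ζ'/ζ(σ) < 1/(σ−1)`), with `0.0463 + 4.62/3 + (log 2)/3 − 1/16 < 1.8`.
[cite: Ford2002Millennium, Lemma 4.6] -/
theorem fordK_one_le {f : ℝ → ℝ} {η D : ℝ} (hf : IsFordSmoothing f η D) (hη : 0 < η)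
    (hη2 : η ≤ 1 / 2) : (fordK f 1).re ≤ (fordLaplace f 0).re + 1.8 * D := by
  obtain ⟨x₀, M, hx₀, hf0, -⟩ := hf.exists_support_bound
  have hfc := hf.contDiff.continuous
  have hD0 := hf.D_nonneg (by linarith)
  have hf00 : 0 ≤ f 0 := hf.nonneg 0
  -- the inequality for `σ ∈ (1, 2]`
  have hσ : ∀ σ : ℝ, 1 < σ → σ ≤ 2 →
      (fordK f σ).re ≤ (fordLaplace f ((σ : ℂ) - 1)).re + 1.8 * D := by
    intro σ h1 h2
    have hS : FordFarZeroSumLT ((σ : ℂ)).im η 0.0463 := by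
      rw [ofReal_im]; exact fordFarZeroSumLT_zero η
    have h := re_fordK_le_zero hf hη hη2 (s := (σ : ℂ)) (by simpa using h1) (by simpa using h2)
      (ofReal_im σ) hS
    rw [ofReal_im, fordNearZeros_zero_eq_empty hη2, Finset.sum_empty, sub_zero] at h
    -- `-f(0) Re ζ'/ζ(σ) ≤ f(0)/(σ - 1)`
    have hζ : -(f 0) * (deriv riemannZeta σ / riemannZeta σ).re ≤ f 0 * (1 / (σ - 1)) := by
      have hlt := norm_deriv_riemannZeta_div_lt (s := (σ : ℂ)) (by simpa using h1)
      rw [ofReal_re] at hlt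
      have hre := (Complex.abs_re_le_norm (deriv riemannZeta σ / riemannZeta σ))
      have := (abs_le.1 (hre.trans hlt.le)).1
      nlinarith
    -- `Re F₀(σ - 1) = Re F(σ - 1) - f(0)/(σ - 1)`
    have hF₀ : (fordLaplace₀ f ((σ : ℂ) - 1)).re = (fordLaplace f ((σ : ℂ) - 1)).re - f 0 * (1 / (σ - 1)) := by
      rw [fordLaplace₀, sub_re]
      congr 1
      rw [show ((σ : ℂ) - 1) = ((σ - 1 : ℝ) : ℂ) by push_cast; ring, ← Complex.ofReal_div, ofReal_re]
      ring
    rw [hF₀] at h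
    have hlog2 := Real.log_two_lt_d9
    nlinarith
  -- the limit `σ → 1⁺`
  have hK : ContinuousAt (fun σ : ℝ ↦ (fordK f σ).re) 1 :=
    ((continuous_re_fordK hf0).comp Complex.continuous_ofReal).continuousAt
  have hF : ContinuousAt (fun σ : ℝ ↦ (fordLaplace f ((σ : ℂ) - 1)).re + 1.8 * D) 1 := by
    have hd := differentiable_fordLaplace hfc hx₀ hf0
    exact ((Complex.continuous_re.comp (hd.continuous.comp (Complex.continuous_ofReal.sub
      continuous_const))).add continuous_const).continuousAt
  have hev : ∀ᶠ σ : ℝ in 𝓝[>] (1 : ℝ), (fordK f (σ : ℂ)).re ≤ (fordLaplace f ((σ : ℂ) - 1)).re + 1.8 * D := by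
    filter_upwards [Ioc_mem_nhdsGT (show (1 : ℝ) < 2 by norm_num)] with σ hσ' using hσ σ hσ'.1 hσ'.2
  have hle := le_of_tendsto_of_tendsto (hK.tendsto.mono_left nhdsWithin_le_nhds)
    (hF.tendsto.mono_left nhdsWithin_le_nhds) hev
  simpa using hle

/-! ### The detector inequality at `s = 1 + it` -/

/-- Numerics of Lemma 4.6: for `t ≥ 1000` and `D ≥ 0`,
`D/t² + D(4.62/3 + (log 2)/3 + (1/6) log(1 + t²)) ≤ D(1.8 + (log t)/3)`
(`log(1 + t²) ≤ 2 log t + 1/t²`). [cite: Ford2002Millennium, Lemma 4.6 (proof)] -/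
theorem numerics_46 {t D : ℝ} (ht : 1000 ≤ t) (hD : 0 ≤ D) :
    D / t ^ 2 + D * (4.62 / 3 + Real.log 2 / 3 + 1 / 6 * Real.log (1 + t ^ 2)) ≤
      D * (1.8 + Real.log t / 3) := by
  have ht0 : 0 < t := by linarith
  have hlog : Real.log (1 + t ^ 2) ≤ 2 * Real.log t + 1 / t ^ 2 := by
    have e : 1 + t ^ 2 = t ^ 2 * (1 + 1 / t ^ 2) := by field_simp; ring
    rw [e, Real.log_mul (by positivity) (by positivity), Real.log_pow]
    have := Real.log_le_sub_one_of_pos (show 0 < 1 + 1 / t ^ 2 by positivity)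
    push_cast
    linarith
  have hlog2 := Real.log_two_lt_d9
  have ht2 : 1 / t ^ 2 ≤ 1 / 1000000 := by
    rw [div_le_div_iff₀ (by positivity) (by norm_num)]; nlinarith
  have h1 : D / t ^ 2 = D * (1 / t ^ 2) := by ring
  rw [h1]
  nlinarith [mul_nonneg hD (show (0:ℝ) ≤ 1 / t ^ 2 by positivity)]

/-- **Lemma 4.5 at `s = 1 + it`** (`t ≠ 0`): the inequality `FordL45.re_fordK_le` at `σ + it`
passed to the limit `σ → 1⁺` (every term is continuous in `σ`: `K` is a finite sum, `ζ(1+it) ≠ 0`,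
`F₀` is analytic off `0`, the near zeros are `≠ 1 + it`):
`Re K(1+it) ≤ −f(0) Re ζ'/ζ(1+it) + Re F₀(it) − Σ_{|1+it−ρ|≤η} m(ρ) Re F₀(1+it−ρ) + D·S
  + D(4.62/3 + (log 2)/3 + (1/6) log(1+t²))`. [cite: Ford2002Millennium, Lemma 4.6 (proof, `σ → 1⁺`)] -/
theorem re_fordK_one_add_le {f : ℝ → ℝ} {η D : ℝ} (hf : IsFordSmoothing f η D) (hη : 0 < η)
    (hη2 : η ≤ 1 / 2) {t : ℝ} (ht : t ≠ 0) {S : ℝ} (hS : FordFarZeroSumLT t η S) :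
    (fordK f (1 + t * I)).re ≤
      -(f 0) * (deriv riemannZeta (1 + t * I) / riemannZeta (1 + t * I)).re
      + (fordLaplace₀ f (1 + t * I - 1)).re
      - (∑ ρ ∈ fordNearZeros t η, (riemannZetaZeroOrder ρ : ℝ) * (fordLaplace₀ f (1 + t * I - ρ)).re)
      + D * S + D * (4.62 / 3 + Real.log 2 / 3 + 1 / 6 * Real.log (1 + t ^ 2)) := by
  classical
  obtain ⟨x₀, M, hx₀, hf0, -⟩ := hf.exists_support_bound
  have hfc := hf.contDiff.continuous
  set s₁ : ℂ := 1 + t * I with hs₁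
  have hs₁re : s₁.re = 1 := by simp [hs₁]
  have hs₁im : s₁.im = t := by simp [hs₁]
  have hζ₁ : riemannZeta s₁ ≠ 0 := riemannZeta_ne_zero_of_one_le_re (by rw [hs₁re])
  have hs₁1 : s₁ ≠ 1 := by
    intro h; have := congrArg Complex.im h; rw [hs₁im] at this; simp at this; exact ht this
  set Z := fordNearZeros t η with hZ
  have hZmem : ∀ ρ ∈ Z, riemannZeta ρ = 0 ∧ ‖1 + t * I - ρ‖ ≤ η := fun ρ hρ ↦ mem_fordNearZeros.1 hρ
  have hZne : ∀ ρ ∈ Z, s₁ - ρ ≠ 0 := by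
    intro ρ hρ h
    rw [sub_eq_zero] at h
    exact hζ₁ (h ▸ (hZmem ρ hρ).1)
  set E : ℝ := 4.62 / 3 + Real.log 2 / 3 + 1 / 6 * Real.log (1 + t ^ 2) with hE
  set Φ : ℝ → ℝ := fun σ ↦ (fordK f ((σ : ℂ) + t * I)).re with hΦ
  set Ψ : ℝ → ℝ := fun σ ↦ -(f 0) * (deriv riemannZeta ((σ : ℂ) + t * I) / riemannZeta ((σ : ℂ) + t * I)).re
      + (fordLaplace₀ f ((σ : ℂ) + t * I - 1)).re
      - (∑ ρ ∈ Z, (riemannZetaZeroOrder ρ : ℝ) * (fordLaplace₀ f ((σ : ℂ) + t * I - ρ)).re)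
      + D * S + D * E with hΨ
  have hineq : ∀ σ : ℝ, 1 < σ → σ ≤ 2 → Φ σ ≤ Ψ σ := by
    intro σ h1 h2
    have him : ((σ : ℂ) + t * I).im = t := by simp
    have hre : ((σ : ℂ) + t * I).re = σ := by simp
    have hS' : FordFarZeroSumLT ((σ : ℂ) + t * I).im η S := by rw [him]; exact hS
    have h := re_fordK_le hf hη hη2 (s := (σ : ℂ) + t * I) (by rw [hre]; exact h1) (by rw [hre]; exact h2) hS'
    simp only [him] at h
    exact h
  have hpath : Continuous fun σ : ℝ ↦ (σ : ℂ) + t * I := by fun_prop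
  have hΦc : ContinuousAt Φ 1 :=
    ((continuous_re_fordK hf0).comp hpath).continuousAt
  have hΨc : ContinuousAt Ψ 1 := by
    have h1 : ContinuousAt (fun σ : ℝ ↦ (deriv riemannZeta ((σ : ℂ) + t * I) /
        riemannZeta ((σ : ℂ) + t * I)).re) 1 := by
      have han := analyticAt_riemannZeta' hs₁1
      have hq : ContinuousAt (fun w : ℂ ↦ deriv riemannZeta w / riemannZeta w) s₁ :=
        han.deriv.continuousAt.div han.continuousAt hζ₁
      have hq' : ContinuousAt (fun σ : ℝ ↦ deriv riemannZeta ((σ : ℂ) + t * I) /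
          riemannZeta ((σ : ℂ) + t * I)) 1 :=
        ContinuousAt.comp (g := fun w : ℂ ↦ deriv riemannZeta w / riemannZeta w)
          (f := fun σ : ℝ ↦ (σ : ℂ) + t * I) (x := (1 : ℝ)) (by simpa [hs₁] using hq) hpath.continuousAt
      exact Complex.continuous_re.continuousAt.comp hq'
    have h2 : ContinuousAt (fun σ : ℝ ↦ (fordLaplace₀ f ((σ : ℂ) + t * I - 1)).re) 1 := by
      have hne : s₁ - 1 ≠ 0 := sub_ne_zero.2 hs₁1
      have hq := (differentiableAt_fordLaplace₀ hfc hx₀ hf0 hne).continuousAt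
      have hq' : ContinuousAt (fun σ : ℝ ↦ fordLaplace₀ f ((σ : ℂ) + t * I - 1)) 1 :=
        ContinuousAt.comp (g := fordLaplace₀ f) (f := fun σ : ℝ ↦ (σ : ℂ) + t * I - 1) (x := (1 : ℝ))
          (by simpa [hs₁] using hq) (hpath.sub continuous_const).continuousAt
      exact Complex.continuous_re.continuousAt.comp hq'
    have h3 : ContinuousAt (fun σ : ℝ ↦ ∑ ρ ∈ Z, (riemannZetaZeroOrder ρ : ℝ) *
        (fordLaplace₀ f ((σ : ℂ) + t * I - ρ)).re) 1 := by
      refine tendsto_finsetSum _ fun ρ hρ ↦ ?_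
      have hq := (differentiableAt_fordLaplace₀ hfc hx₀ hf0 (hZne ρ hρ)).continuousAt
      have hq' : ContinuousAt (fun σ : ℝ ↦ fordLaplace₀ f ((σ : ℂ) + t * I - ρ)) 1 :=
        ContinuousAt.comp (g := fordLaplace₀ f) (f := fun σ : ℝ ↦ (σ : ℂ) + t * I - ρ) (x := (1 : ℝ))
          (by simpa [hs₁] using hq) (hpath.sub continuous_const).continuousAt
      exact continuousAt_const.mul (Complex.continuous_re.continuousAt.comp hq')
    simp only [hΨ]
    exact ((((h1.const_mul (-(f 0))).add h2).sub h3).add continuousAt_const).add continuousAt_const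
  have hev : ∀ᶠ σ in 𝓝[>] (1 : ℝ), Φ σ ≤ Ψ σ := by
    filter_upwards [Ioc_mem_nhdsGT (show (1 : ℝ) < 2 by norm_num)] with σ hσ' using hineq σ hσ'.1 hσ'.2
  have hlim : Φ 1 ≤ Ψ 1 := le_of_tendsto_of_tendsto (hΦc.tendsto.mono_left nhdsWithin_le_nhds)
    (hΨc.tendsto.mono_left nhdsWithin_le_nhds) hev
  simp only [hΦ, hΨ, hE, ofReal_one] at hlim
  exact hlim

/-- **The near zeros with `Re ρ ≤ 1 − η` do not contribute to the cotangent sum**: such a zero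
with `|1 + it − ρ| ≤ η` is `ρ = 1 − η + it`, where `h_η(η) = (π/2η) cot(π/2) = 0`. Hence the sum of
`m(ρ) Re h_η(1 + it − ρ)` over all near zeros equals the sum over those with `Re ρ > 1 − η`.
[cite: Ford2002Millennium, Lemma 4.6 (proof)] -/
theorem sum_fordCot_near_eq_filter {t η : ℝ} (hη : 0 < η) :
    ∑ ρ ∈ fordNearZeros t η, (riemannZetaZeroOrder ρ : ℝ) * (fordCot η (1 + t * I - ρ)).re =
      ∑ ρ ∈ (fordNearZeros t η).filter (fun ρ ↦ 1 - η < ρ.re),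
        (riemannZetaZeroOrder ρ : ℝ) * (fordCot η (1 + t * I - ρ)).re := by
  classical
  rw [← Finset.sum_filter_add_sum_filter_not (fordNearZeros t η) (fun ρ ↦ 1 - η < ρ.re)]
  rw [add_eq_left]
  refine Finset.sum_eq_zero fun ρ hρ ↦ ?_
  rw [Finset.mem_filter, not_lt, mem_fordNearZeros] at hρ
  obtain ⟨⟨-, hn⟩, hρre⟩ := hρ
  have hz : 1 + t * I - ρ = (η : ℂ) := by
    have hre1 : η ≤ (1 + t * I - ρ).re := by simp; linarith
    have hsq : ‖1 + t * I - ρ‖ ^ 2 ≤ η ^ 2 := pow_le_pow_left₀ (norm_nonneg _) hn 2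
    rw [Complex.sq_norm, Complex.normSq_apply] at hsq
    have him0 : (1 + t * I - ρ).im = 0 := by nlinarith [sq_nonneg ((1 + t * I - ρ).im)]
    have hre0 : (1 + t * I - ρ).re = η := by nlinarith [sq_nonneg ((1 + t * I - ρ).im)]
    exact Complex.ext (by simpa using hre0) (by simpa using him0)
  rw [hz, fordCot]
  have hη0 : (η : ℂ) ≠ 0 := by exact_mod_cast hη.ne'
  have hπη : (((π / (2 * η) : ℝ) : ℂ) * (η : ℂ)) = ((π / 2 : ℝ) : ℂ) := by
    push_cast; field_simp
  rw [hπη, Complex.cot_eq_cos_div_sin]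
  have : Complex.cos ((π / 2 : ℝ) : ℂ) = 0 := by
    rw [show (((π / 2 : ℝ)) : ℂ) = (π : ℂ) / 2 by push_cast; ring]; exact Complex.cos_pi_div_two
  rw [this]
  simp

/-- **The near sum of `FordDetectorIneq` in terms of `F₀` and `h_η`**:
`fordNearSum f η t = Σ m(ρ) Re F₀(1+it−ρ) + f(0) Σ m(ρ) Re h_η(1+it−ρ)` (`F₀ = F − f(0)/z`).
[cite: Ford2002Millennium, Lemma 4.6] -/
theorem fordNearSum_eq (f : ℝ → ℝ) (η t : ℝ) :
    fordNearSum f η t =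
      (∑ ρ ∈ fordNearZeros t η, (riemannZetaZeroOrder ρ : ℝ) * (fordLaplace₀ f (1 + t * I - ρ)).re)
      + f 0 * ∑ ρ ∈ fordNearZeros t η, (riemannZetaZeroOrder ρ : ℝ) * (fordCot η (1 + t * I - ρ)).re := by
  rw [fordNearSum, Finset.mul_sum, ← Finset.sum_add_distrib]
  refine Finset.sum_congr rfl fun ρ _ ↦ ?_
  set z : ℂ := 1 + t * I - ρ with hz
  have e1 : ((f 0 : ℂ) * (fordCot η z - 1 / z)).re = f 0 * ((fordCot η z).re - (1 / z).re) := by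
    rw [Complex.re_ofReal_mul, Complex.sub_re]
  have e2 : (fordLaplace₀ f z).re = (fordLaplace f z).re - f 0 * (1 / z).re := by
    rw [fordLaplace₀, Complex.sub_re, div_eq_mul_inv, Complex.re_ofReal_mul, one_div]
  have e3 : fordCot η z = ((π / (2 * η) : ℝ) : ℂ) * Complex.cot (((π / (2 * η) : ℝ) : ℂ) * z) := rfl
  rw [← e3, Complex.add_re, e1, e2]
  ring

/-- **Ford 2002, Lemma 4.6, first assertion (the smoothed zero detector at `s = 1 + it`)**, for
the constants `A ≥ 6`, `B > 0` of (3.1), `0 < η ≤ 1/2`, an admissible smoothing `f` with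
`F₀`-constant `D`, `t ≥ 1000`, and any bound `S` of the strict far-zero sum
`Σ_{|1+it−ρ|>η} m(ρ)/|1+it−ρ|²`: `FordDetectorIneq A B η f D t S`, i.e.
`Re K(1+it) ≤ −Σ_{|1+it−ρ|≤η} m(ρ) Re{F(s−ρ) + f(0)((π/2η)cot(π(s−ρ)/2η) − 1/(s−ρ))}
  + (f(0)/2η)[(2/3) log log t + Bη^{3/2} log t + log A − ½∫ log|ζ(1+η+it+2ηiu/π)|/cosh²u du]
  + D(1.8 + (log t)/3 + S)`.
Proof (Ford's): `re_fordK_one_add_le`, then Lemma 4.1 at `1 + it`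
(`FordLemma41.ford_lemma_4_1_one`, which needs `A ≥ 6` for Ford's Lemma 3.4 on `Re s = 1 − η`)
with the near zeros of real part `> 1 − η` (`sum_fordCot_near_eq_filter`), `|F₀(it)| ≤ D/t²`, and
`numerics_46`. [cite: Ford2002Millennium, Lemma 4.6] [cite: MossinghoffTrudgianYangRNT2024, Lemma 4.2] -/
theorem fordDetectorIneq {A B : ℝ} (hA : 6 ≤ A) (hB : 0 < B) (hR : RichertBound A B) {η : ℝ}
    (hη : 0 < η) (hη2 : η ≤ 1 / 2) {f : ℝ → ℝ} {D : ℝ} (hf : IsFordSmoothing f η D) {t : ℝ}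
    (ht : 1000 ≤ t) {S : ℝ} (hS : FordFarZeroSumLT t η S) : FordDetectorIneq A B η f D t S := by
  classical
  have hD0 := hf.D_nonneg (by linarith)
  have hf00 : 0 ≤ f 0 := hf.nonneg 0
  have ht0 : 0 < t := by linarith
  have hlim := re_fordK_one_add_le hf hη hη2 ht0.ne' hS
  set Z := fordNearZeros t η with hZ
  -- Lemma 4.1 at `1 + it` with the near zeros of real part `> 1 − η`
  set Z₁ := Z.filter (fun ρ ↦ 1 - η < ρ.re) with hZ₁
  have hZ₁S : ∀ ρ ∈ Z₁, riemannZeta ρ = 0 ∧ 1 - η < ρ.re := by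
    intro ρ hρ
    rw [hZ₁, Finset.mem_filter, hZ, mem_fordNearZeros] at hρ
    exact ⟨hρ.1.1, hρ.2⟩
  have h41 := FordLemma41.ford_lemma_4_1_one (t := t) hA hB.le hR hη hη2 (by linarith) Z₁ hZ₁S
  have hcot_neg : ∀ ρ : ℂ, fordCot η (ρ - (1 + t * I)) = -fordCot η (1 + t * I - ρ) := by
    intro ρ; rw [← fordCot_neg]; congr 1; ring
  have hcot_sum := sum_fordCot_near_eq_filter (t := t) hη
  rw [← hZ, ← hZ₁] at hcot_sum
  have hnear := fordNearSum_eq f η t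
  rw [← hZ] at hnear
  -- `|F₀(it)| ≤ D/t²`
  have hF₀t : (fordLaplace₀ f (1 + t * I - 1)).re ≤ D / t ^ 2 := by
    have e : (1 + t * I - 1 : ℂ) = t * I := by ring
    rw [e]
    have hnorm : ‖(t : ℂ) * I‖ = t := by simp [abs_of_pos ht0]
    have hb := hf.laplace_bound (t * I) (by simp) (by rw [hnorm]; linarith)
    rw [← fordLaplace₀, hnorm] at hb
    exact (Complex.re_le_norm _).trans hb
  have hnum := numerics_46 ht hD0
  -- assemble
  rw [FordDetectorIneq, hnear]
  have h41' := mul_le_mul_of_nonneg_left h41 hf00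
  simp only [hcot_neg, Complex.neg_re, mul_neg, Finset.sum_neg_distrib] at h41'
  rw [← hcot_sum] at h41'
  -- bookkeeping
  set Kre := (fordK f (1 + t * I)).re with hKre
  set Zre := (deriv riemannZeta (1 + t * I) / riemannZeta (1 + t * I)).re with hZre
  set NF := ∑ ρ ∈ Z, (riemannZetaZeroOrder ρ : ℝ) * (fordLaplace₀ f (1 + t * I - ρ)).re with hNF
  set NG := ∑ ρ ∈ Z, (riemannZetaZeroOrder ρ : ℝ) * (fordCot η (1 + t * I - ρ)).re with hNG
  set FL := fordLogZetaIntegral (1 + η) t (2 * η / π) with hFL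
  set F0t := (fordLaplace₀ f (1 + t * I - 1)).re with hF0t
  set LL := Real.log (Real.log t) with hLL
  set L := Real.log t with hL
  set P := η ^ (3 / 2 : ℝ) with hP
  have step1 : Kre ≤ -(f 0 * Zre) + D / t ^ 2 - NF + D * S +
      D * (4.62 / 3 + Real.log 2 / 3 + 1 / 6 * Real.log (1 + t ^ 2)) := by linarith [hlim, hF₀t]
  have step2 : -(f 0 * Zre) ≤ f 0 * (-NG + 1 / (2 * η) * (Real.log A + B * P * L + 2 / 3 * LL)
      - 1 / (4 * η) * FL) := h41'
  have step3 : Kre ≤ -(NF + f 0 * NG) + f 0 / (2 * η) * (2 / 3 * LL + B * P * L + Real.log A - 1 / 2 * FL)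
      + D * (1.8 + L / 3 + S) := by
    have e : f 0 * (-NG + 1 / (2 * η) * (Real.log A + B * P * L + 2 / 3 * LL) - 1 / (4 * η) * FL) =
        -(f 0 * NG) + f 0 / (2 * η) * (2 / 3 * LL + B * P * L + Real.log A - 1 / 2 * FL) := by
      field_simp
      ring
    rw [e] at step2
    linarith [step1, step2, hnum]
  exact step3

/-- **Ford 2002, Lemma 4.6 = the hypothesis `h42` of
`zero_inequality_mossinghoff_trudgian_yang_of_hsw` for `A ≥ 6`**: for the constants `A ≥ 6`,
`B > 0` of (3.1), `0 < η ≤ 1/2` and every admissible smoothing `f` with `F₀`-constant `D`: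
the detector inequality `FordDetectorIneq A B η f D t S` for all `t ≥ 1000` and all bounds `S` of
the strict far-zero sum, together with `K(1) ≤ F(0) + 1.8D`. (The restriction `A ≥ 6` comes from
Ford's Lemma 3.4 on the line `Re s = 1 − η` inside Lemma 4.1; the named fact
`zero_inequality_mossinghoff_trudgian_yang` quantifies `A > 6.5`.)
[cite: Ford2002Millennium, Lemma 4.6] [cite: MossinghoffTrudgianYangRNT2024, Lemmas 4.2–4.3] -/
theorem ford_lemma_4_6 {A B : ℝ} (hA : 6 ≤ A) (hB : 0 < B) (hR : RichertBound A B) {η : ℝ}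
    (hη : 0 < η) (hη2 : η ≤ 1 / 2) {f : ℝ → ℝ} {D : ℝ} (hf : IsFordSmoothing f η D) :
    (∀ t : ℝ, 1000 ≤ t → ∀ S : ℝ, FordFarZeroSumLT t η S → FordDetectorIneq A B η f D t S) ∧
      (fordK f 1).re ≤ (fordLaplace f 0).re + 1.8 * D :=
  ⟨fun _ ht _ hS ↦ fordDetectorIneq hA hB hR hη hη2 hf ht hS, fordK_one_le hf hη hη2⟩

/-! ### The raw detector (both `log|ζ|` integrals kept) and MTY Lemma 6.1 -/

/-- **Ford's (4.9)–(4.10) in raw form, for every admissible smoothing** (`IsFordSmoothing f η D`,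
`0 < η ≤ 1/2`, `t ≥ 1000`, `S` a bound of the strict far-zero sum): `FordDetectorIneqRaw η f D t S`,
`Re K(1+it) ≤ −fordNearSum f η t + (f(0)/4η)[∫log|ζ(1−η+…)| − ∫log|ζ(1+η+…)|] + D(1.8 + (log t)/3 + S)`
— `re_fordK_one_add_le` with Ford's zero detector at `σ = 1` for every `η`
(`FordZetaDetector.ford_zero_detector_zeta_one`) in place of Lemma 4.1 (no (3.1) needed). Compare
`FordL46.fordDetectorIneqRaw_of_admissible` (the same for the `C²` smoothings of the exact explicit
formula, with the better constant `5/4`). [cite: Ford2002Millennium, Lemma 4.6 (proof)]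
[cite: MossinghoffTrudgianYangRNT2024, Lemma 4.2, (4.8)] -/
theorem fordDetectorIneqRaw {η : ℝ} (hη : 0 < η) (hη2 : η ≤ 1 / 2) {f : ℝ → ℝ} {D : ℝ}
    (hf : IsFordSmoothing f η D) {t : ℝ} (ht : 1000 ≤ t) {S : ℝ} (hS : FordFarZeroSumLT t η S) :
    FordDetectorIneqRaw η f D t S := by
  classical
  have hD0 := hf.D_nonneg (by linarith)
  have hf00 : 0 ≤ f 0 := hf.nonneg 0
  have ht0 : 0 < t := by linarith
  have hlim := re_fordK_one_add_le hf hη hη2 ht0.ne' hS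
  set Z := fordNearZeros t η with hZ
  set Z₁ := Z.filter (fun ρ ↦ 1 - η < ρ.re) with hZ₁
  have hZ₁S : ∀ ρ ∈ Z₁, riemannZeta ρ = 0 ∧ 1 - η < ρ.re := by
    intro ρ hρ
    rw [hZ₁, Finset.mem_filter, hZ, mem_fordNearZeros] at hρ
    exact ⟨hρ.1.1, hρ.2⟩
  have hdet := FordZetaDetector.ford_zero_detector_zeta_one hη hη2 ht0.ne' Z₁ hZ₁S
  simp only [ofReal_one] at hdet
  have hcot_neg : ∀ ρ : ℂ, fordCot η (ρ - (1 + t * I)) = -fordCot η (1 + t * I - ρ) := by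
    intro ρ; rw [← fordCot_neg]; congr 1; ring
  have hcot_sum := sum_fordCot_near_eq_filter (t := t) hη
  rw [← hZ, ← hZ₁] at hcot_sum
  have hnear := fordNearSum_eq f η t
  rw [← hZ] at hnear
  have hF₀t : (fordLaplace₀ f (1 + t * I - 1)).re ≤ D / t ^ 2 := by
    have e : (1 + t * I - 1 : ℂ) = t * I := by ring
    rw [e]
    have hnorm : ‖(t : ℂ) * I‖ = t := by simp [abs_of_pos ht0]
    have hb := hf.laplace_bound (t * I) (by simp) (by rw [hnorm]; linarith)
    rw [← fordLaplace₀, hnorm] at hb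
    exact (Complex.re_le_norm _).trans hb
  have hnum := numerics_46 ht hD0
  rw [FordDetectorIneqRaw, hnear]
  have hdet' := mul_le_mul_of_nonneg_left hdet hf00
  simp only [hcot_neg, Complex.neg_re, mul_neg, Finset.sum_neg_distrib] at hdet'
  rw [← hcot_sum] at hdet'
  -- the two integrals are `fordLogZetaIntegral (1 ∓ η) t (2η/π)` by definition
  change -(f 0 * (deriv riemannZeta (1 + t * I) / riemannZeta (1 + t * I)).re) ≤
    f 0 * (-(∑ ρ ∈ Z, (riemannZetaZeroOrder ρ : ℝ) * (fordCot η (1 + t * I - ρ)).re) +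
      1 / (4 * η) * (fordLogZetaIntegral (1 - η) t (2 * η / π) - fordLogZetaIntegral (1 + η) t (2 * η / π)))
    at hdet'
  set Kre := (fordK f (1 + t * I)).re with hKre
  set Zre := (deriv riemannZeta (1 + t * I) / riemannZeta (1 + t * I)).re with hZre
  set NF := ∑ ρ ∈ Z, (riemannZetaZeroOrder ρ : ℝ) * (fordLaplace₀ f (1 + t * I - ρ)).re with hNF
  set NG := ∑ ρ ∈ Z, (riemannZetaZeroOrder ρ : ℝ) * (fordCot η (1 + t * I - ρ)).re with hNG
  set FL1 := fordLogZetaIntegral (1 - η) t (2 * η / π) with hFL1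
  set FL2 := fordLogZetaIntegral (1 + η) t (2 * η / π) with hFL2
  set F0t := (fordLaplace₀ f (1 + t * I - 1)).re with hF0t
  set L := Real.log t with hL
  have step1 : Kre ≤ -(f 0 * Zre) + D / t ^ 2 - NF + D * S +
      D * (4.62 / 3 + Real.log 2 / 3 + 1 / 6 * Real.log (1 + t ^ 2)) := by linarith [hlim, hF₀t]
  have step2 : -(f 0 * Zre) ≤ f 0 * (-NG + 1 / (4 * η) * (FL1 - FL2)) := hdet'
  have e : f 0 * (-NG + 1 / (4 * η) * (FL1 - FL2)) = -(f 0 * NG) + f 0 / (4 * η) * (FL1 - FL2) := by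
    field_simp
  rw [e] at step2
  linarith [step1, step2, hnum]

/-- **The hypothesis `h42` of `zero_inequality_intermediate_of_ford'` discharged**: for every
`η ∈ (0, 1/2]` and every admissible smoothing, the raw detector inequality for all `t ≥ 1000` and all
bounds of the far-zero sum over `|1+it−ρ| ≥ η`, and `K(1) ≤ F(0) + 1.8D`.
[cite: Ford2002Millennium, Lemma 4.6] [cite: MossinghoffTrudgianYangRNT2024, Lemma 4.2] -/
theorem h42_raw (η : ℝ) (hη : 0 < η) (hη2 : η ≤ 1 / 2) (f : ℝ → ℝ) (D : ℝ)
    (hf : IsFordSmoothing f η D) :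
    (∀ t : ℝ, 1000 ≤ t → ∀ S : ℝ, FordFarZeroSumLE t η S → FordDetectorIneqRaw η f D t S) ∧
      (fordK f 1).re ≤ (fordLaplace f 0).re + 1.8 * D :=
  ⟨fun _ ht _ hS ↦ fordDetectorIneqRaw hη hη2 hf ht hS.lt, fordK_one_le hf hη hη2⟩

/-- **MTY Lemma 6.1 (the intermediate-height zero inequality) from Patel's bound, Ford's (9.1)
and the numerical constant `Σ ≤ 0.851` only**: the in-tree assembly
`zero_inequality_intermediate_of_ford'` with its detector hypothesis `h42` discharged by `h42_raw`.
[cite: MossinghoffTrudgianYangRNT2024, Lemma 6.1] [cite: Ford2002Millennium, Lemma 4.6] -/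
theorem zero_inequality_intermediate_of_patel_91
    (hP : zeta_half_line_patel)
    (h91 : ∀ τ : ℝ, 10000 ≤ τ → FordFarZeroSumLE τ (1 / 2)
      (3.2357 * Real.log τ + 5.316 * Real.log (Real.log τ) + 16.134 - 4 * fordN τ (1 / 2)))
    (hΛ : fordMangoldtSum ≤ 0.851) :
    zero_inequality_intermediate_mossinghoff_trudgian_yang :=
  zero_inequality_intermediate_of_ford' (fun η hη hη2 f D hf ↦ h42_raw η hη hη2 f D hf) hP h91 hΛ

/-! ### MTY Lemma 4.7 with the detector discharged -/

/-- **MTY Lemma 4.7 (with the Lemma-4.5 constant as a parameter) from MTY Lemma 4.5 and (3.8)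
only**: the in-tree assembly `zero_inequality_mossinghoff_trudgian_yang_of_detector_bound_with'`
(detector asked for `A > 6.5` only) with `hdet` discharged by `ford_lemma_4_6` and the far-zero
bound `FarZeros.mty_lemma_4_6_with` (MTY Lemma 4.6 from Lemma 4.5 with constant `c₄₅` and (3.8)).
With the printed `c₄₅ = 0.479` this is the named fact up to `0.479 − 500/1879 ≤ 0.213`
(`zero_inequality_mossinghoff_trudgian_yang_of_h45`); the printed `0.479` rests on a step of
Ford's Lemma 4.2 not covered by Ford's Lemma 3.1 (see `VinogradovKorobovNearZeroCount.lean`).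
[cite: MossinghoffTrudgianYangRNT2024, Lemmas 4.5–4.7] [cite: Ford2002Millennium, Lemmas 4.6, 7.1] -/
theorem zeroInequalityMTYWith_of_h45 {c45 : ℝ} (hc45 : 0 ≤ c45)
    (h45 : ∀ A B : ℝ, 1 < A → 0 < B → RichertBound A B → ∀ t u : ℝ, 100 ≤ t → 0 < u → u ≤ 1 / 4 →
      fordN t u ≤ 1.3478 * u ^ (3 / 2 : ℝ) * B * Real.log t + c45
        + (Real.log A - Real.log u + 2 / 3 * Real.log (Real.log t)) / 1.879)
    (h38 : zetaZeroCount_hasanalizade_shen_wong) :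
    zeroInequalityMTYWith (c45 - 500 / 1879) :=
  zero_inequality_mossinghoff_trudgian_yang_of_detector_bound_with' (c45 - 500 / 1879)
    (fun A B hA hB hR η hη hη4 f D hf ↦
      ⟨fun t ht ↦ (ford_lemma_4_6 (by linarith) hB hR hη (by linarith) hf).1 t (by linarith) _
          fun T hT ↦ FarZeros.mty_lemma_4_6_with h38 (by linarith) hB hc45 (h45 A B (by linarith) hB hR)
            ht hη hη4 T hT,
        (ford_lemma_4_6 (by linarith) hB hR hη (by linarith) hf).2⟩)
    mty_lemma_4_4' fun _ hθ hθ' ↦ fordKernelFacts hθ hθ'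

/-- **Lemma 4.7 of Mossinghoff–Trudgian–Yang from MTY Lemma 4.5 (as printed) and (3.8)**: the
named fact `zero_inequality_mossinghoff_trudgian_yang` follows from the printed near-zero count
(Lemma 4.5, constant `0.479`, as a hypothesis for every `A > 1`, `B > 0` with (3.1)) and the
Riemann–von Mangoldt formula (3.8) of Hasanalizade–Shen–Wong (the named fact
`zetaZeroCount_hasanalizade_shen_wong`), all of Ford's analytic inputs (Lemmas 2.2, 3.1–3.4,
4.1, 4.4–4.6, 5.x kernel facts) being theorems of the tree.
[cite: MossinghoffTrudgianYangRNT2024, Lemma 4.7] -/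
theorem zero_inequality_mossinghoff_trudgian_yang_of_h45
    (h45 : ∀ A B : ℝ, 1 < A → 0 < B → RichertBound A B → ∀ t u : ℝ, 100 ≤ t → 0 < u → u ≤ 1 / 4 →
      fordN t u ≤ 1.3478 * u ^ (3 / 2 : ℝ) * B * Real.log t + 0.479
        + (Real.log A - Real.log u + 2 / 3 * Real.log (Real.log t)) / 1.879)
    (h38 : zetaZeroCount_hasanalizade_shen_wong) :
    zero_inequality_mossinghoff_trudgian_yang := by
  rw [zero_inequality_mossinghoff_trudgian_yang_iff_with]
  refine zero_inequality_mossinghoff_trudgian_yang_of_detector_bound_with' 0.213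
    (fun A B hA hB hR η hη hη4 f D hf ↦
      ⟨fun t ht ↦ (ford_lemma_4_6 (by linarith) hB hR hη (by linarith) hf).1 t (by linarith) _
          fun T hT ↦ (FarZeros.mty_lemma_4_6_with h38 (by linarith) hB (by norm_num) (h45 A B (by linarith) hB hR)
            ht hη hη4 T hT).trans (FarZeros.mtyFarZeroBoundWith_mono (by norm_num) A B t η),
        (ford_lemma_4_6 (by linarith) hB hR hη (by linarith) hf).2⟩)
    mty_lemma_4_4' fun _ hθ hθ' ↦ fordKernelFacts hθ hθ'

end FordL46S

end Literature.NumberTheory.LFunctions
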